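import Literature.Analysis.FunctionSpaces.SobolevTraceDensityProofs
import Literature.Analysis.FunctionSpaces.SobolevDomainGNSProofs
import Literature.Analysis.FunctionSpaces.GagliardoNirenbergSobolevLowerSet
import HarnessLib

/-!
# Discharged fact: the Sobolev embedding `W^{1,p}(Ω) ⊆ L^{p*}(Ω)` on bounded Lipschitz domains

`Literature.Analysis.FunctionSpaces.SobolevTrace` states the Sobolev embedding on a bounded
Lipschitz domain as the named fact `Literature.Analysis.FunctionSpaces.sobolev_embedding_domain`: for `1 ≤ p < n = dim E'`,
`p* = np/(n-p)`, an additive Haar measure `μ` and a complete `F`, every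
`f ∈ W^{1,p}(Ω; F)` lies in `L^{p*}(Ω)` (R. A. Adams, J. J. F. Fournier, *Sobolev Spaces*, 2nd ed.
(2003), Thm. 4.12, Part I, Case C with `m = 1`; in the first edition, R. A. Adams, *Sobolev
Spaces* (1975), Thm. 5.4, Part I, Case A, imbedding (4) with `m = 1`, proved as Lemma 5.10,
for bounded domains with the cone property — which bounded Lipschitz domains have, Adams ¶4.5,
¶4.7; L. C. Evans, *PDE*, §5.6.1, Theorem 2 for `C¹` boundaries). This file proves it:

* `Literature.sobolev_embedding_domain_holds : sobolev_embedding_domain`, through the quantitative form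
  `Literature.Analysis.FunctionSpaces.exists_eLpNorm_le_of_memSobolevDomain_one`:
  `‖f‖_{L^{p*}(Ω)} ≤ C (‖f‖_{L^p(Ω)} + ‖Df‖_{L^p(Ω)})` with `C = C(Ω, p, μ)`;
* `Literature.Analysis.FunctionSpaces.memLp_of_memSobolevDomain_one`: the same embedding as a closed theorem with all hypotheses
  explicit;
* `Literature.sobolev_embedding_domain'_holds : sobolev_embedding_domain'`, the discharge of the corrected
  named fact of `SobolevTrace`.

**The named fact is mis-stated** (too strong): being a `def`, `sobolev_embedding_domain` only
received as parameters the section instances its body uses, so its proposition lacks the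
section's `[BorelSpace E']`, `[FiniteDimensional ℝ E']` and `[CompleteSpace F]`. Finite
dimension follows from `p < finrank ℝ E'`; the other two do not, and for non-complete `F` the
proposition is false (all Bochner integrals vanish, `W^{1,p}(Ω; F) = L^p(Ω; F) ⊄ L^{p*}(Ω; F)`).
Accordingly `sobolev_embedding_domain_holds` carries the instance hypotheses `[BorelSpace E']`
and `[CompleteSpace F]` (as does the accepted `Literature.Analysis.FunctionSpaces.traceData_ae_eq_holds` for `[BorelSpace E']`),
under which it proves the fact verbatim; `memLp_of_memSobolevDomain_one` is the corrected
statement, proved; and `SobolevTrace` records the corrected named fact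
`Literature.Analysis.FunctionSpaces.sobolev_embedding_domain'` (hypotheses inside the proposition).

**Scope versus print.** Adams states Lemma 5.10 (and Thm. 5.4, Part I, Case A, imbedding (4))
for scalar-valued `u` on a bounded domain with the cone property, and as a bounded *imbedding*
`‖u‖_{0,q,Ω} ≤ K ‖u‖_{1,p,Ω}` (Adams ¶5.3). Here `Ω` is a bounded Lipschitz domain (which has the
cone property, Adams ¶4.5, ¶4.7), the codomain is any complete real normed space `F`, and `μ` is
any additive Haar measure; the imbedding inequality is
`Literature.Analysis.FunctionSpaces.exists_eLpNorm_le_of_memSobolevDomain_one`, and the bare containment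
`W^{1,p}(Ω) ⊆ L^{p*}(Ω)` recorded by the named facts is equivalent to the imbedding by the
closed-graph remark of Adams ¶5.2.

## Proof (Adams 1975, Lemma 5.10, with Lipschitz charts in place of Gagliardo's decomposition)

Adams proves Lemma 5.10 by (i) decomposing `Ω` (Theorem 4.8) into finitely many pieces each of
which contains, with every point `x`, a coordinate segment `x + t eᵢ`, `0 ≤ t < 1` ("after a
suitable nonsingular linear transformation"), (ii) density of `C^∞(Ω̄)` (Theorem 3.18),
(iii) on each piece, Gagliardo's one-sided line integration of `|u|^γ`, `γ = p(n-1)/(n-p)`,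
the combinatorial Lemma 5.9 and Hölder's inequality, and (iv) continuity. Here:

1. *Pieces.* `∂Ω` is compact and covered by the half-balls `B(x, r_x/2)` of Lipschitz charts
   (`IsLipschitzGraphNear Ω x r_x`: `Ω ∩ B(x, r_x) = U_x ∩ B(x, r_x)` with `U_x` the strict
   epigraph `{γ(y - ⟪y,u⟫u) < ⟪y,u⟫}` of a `K`-Lipschitz `γ` in a unit direction `u`); with `Ω`
   itself this is a finite open cover of `Ω̄`, and Mathlib's
   `SmoothPartitionOfUnity.exists_isSubordinate` gives smooth `ρᵢ` with `Σ ρᵢ = 1` on `Ω̄`.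
2. *The linear transformation* (`Literature.Analysis.FunctionSpaces.exists_equiv_forall_add_smul_mem_epigraph`). For an
   orthonormal basis `(bᵢ)` with `b₀ = u`, the vectors `vᵢ = bᵢ + (K+1) u` form a basis lying in
   the cone `{K ‖v - ⟪v,u⟫u‖ ≤ ⟪v,u⟫}`, along which the epigraph `U` is invariant:
   `x ∈ U, s ≥ 0 ⇒ x + s vᵢ ∈ U`. In the coordinates `e` with axes `-vᵢ`, `U` is therefore a
   *coordinate-lower set*, and the Gagliardo–Nirenberg–Sobolev inequality on such sets
   (`Literature.Analysis.FunctionSpaces.exists_eLpNorm_restrict_le_mul_eLpNorm_restrict_fderiv`,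
   `Literature.Analysis.FunctionSpaces.GagliardoNirenbergSobolevLowerSet` — step (iii)) gives
   `‖ψ‖_{L^{p*}(U)} ≤ C_U ‖Dψ‖_{L^p(U)}` for all `ψ ∈ C¹_c(E')`.
3. *Smooth functions* (`Literature.Analysis.FunctionSpaces.exists_eLpNorm_le_add_of_contDiff`). For `φ ∈ C¹(E')`,
   `φ = Σᵢ ρᵢ φ` on `Ω`; the interior piece `ρ₀ φ ∈ C¹_c(Ω)` obeys the whole-space inequality
   (`Literature.Analysis.FunctionSpaces.eLpNorm_le_mul_eLpNorm_fderiv_of_eq`), a boundary piece `ρⱼ φ` is supported in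
   `B(xⱼ, rⱼ)` where `Ω` and `U_{xⱼ}` agree, so step 2 applies with norms over `Ω`; and
   `‖D(ρᵢ φ)‖_{L^p(Ω)} ≤ ‖Dφ‖_{L^p(Ω)} + sup ‖Dρᵢ‖ ‖φ‖_{L^p(Ω)}`. Summing,
   `‖φ‖_{L^{p*}(Ω)} ≤ C (‖φ‖_{L^p(Ω)} + ‖Dφ‖_{L^p(Ω)})`.
4. *Continuity* (`Literature.Analysis.FunctionSpaces.exists_eLpNorm_le_of_memSobolevDomain_one`). For `f ∈ W^{1,p}(Ω)` with weak
   derivative `g`, smooth `φₖ → f` in `W^{1,p}(Ω)` (`Literature.Analysis.FunctionSpaces.smooth_upToBoundary_dense_one`, Adams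
   Thm. 3.18); then `φₖ → f` and `Dφₖ → g` in `L^p(Ω)`
   (`Literature.Analysis.FunctionSpaces.tendsto_eLpNorm_fderiv_of_tendsto_eSobolevDomainNorm_of_contDiff`), a subsequence
   converges a.e., and Fatou's lemma (`MeasureTheory.Lp.eLpNorm_lim_le_liminf_eLpNorm`) yields
   `‖f‖_{L^{p*}(Ω)} ≤ C (‖f‖_{L^p(Ω)} + ‖g‖_{L^p(Ω)}) < ∞`.

## References

* R. A. Adams, *Sobolev Spaces*, Academic Press (1975), Thm. 5.4, Lemma 5.10 and Remark 5.11;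
  Thm. 3.18.
* R. A. Adams, J. J. F. Fournier, *Sobolev Spaces*, 2nd ed., Academic Press (2003), Thm. 4.12.
* L. C. Evans, *Partial Differential Equations*, 2nd ed., AMS (2010), §5.6.1, Theorems 1–2.
-/

noncomputable section

open MeasureTheory TopologicalSpace Set Function Filter Metric Bornology Module
open scoped ENNReal NNReal ContDiff Topology InnerProductSpace Manifold

namespace Literature.Analysis.FunctionSpaces

/-! ### Cone-adapted coordinates for a Lipschitz epigraph -/

section Cone

variable {E' : Type*} [NormedAddCommGroup E'] [InnerProductSpace ℝ E'] [FiniteDimensional ℝ E']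

/-- **Cone property of a Lipschitz epigraph, linearised.** Let `u` be a unit vector and
`γ : E' → ℝ` `K`-Lipschitz, and let `U = {y | γ(y - ⟪y,u⟫u) < ⟪y,u⟫}` be the strict epigraph of
`γ` over the hyperplane `uᗮ`. There is a linear isomorphism `e : E' ≃L[ℝ] ℝⁿ` whose coordinate
axes `e⁻¹(eᵢ) = -(bᵢ + (K+1)u)` (`(bᵢ)` an orthonormal basis with `b₀ = u`) point *out of* the
cone `{K ‖v - ⟪v,u⟫u‖ ≤ ⟪v,u⟫}`, so that `U` is invariant under `x ↦ x + t e⁻¹(eᵢ)` for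
`t ≤ 0`: `γ` grows at most by `K |t|` while the height `⟪·,u⟫` grows at least by `K |t|`.
(Adams, *Sobolev Spaces* (1975), Lemma 5.10: the "suitable nonsingular linear transformation"
making the segments of the cone condition parallel to the coordinate axes; ¶4.3–4.5 and ¶4.7:
bounded domains with locally Lipschitz boundary have the strong local Lipschitz property, hence
the uniform cone property, hence the cone property.) [cite: Adams1975, Lemma 5.10 (proof)] -/
theorem exists_equiv_forall_add_smul_mem_epigraph {u : E'} (hu : ‖u‖ = 1) {γ : E' → ℝ} {K : ℝ≥0}
    (hγ : LipschitzWith K γ) :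
    ∃ e : E' ≃L[ℝ] (Fin (finrank ℝ E') → ℝ),
      ∀ x ∈ {y : E' | γ (y - ⟪y, u⟫_ℝ • u) < ⟪y, u⟫_ℝ}, ∀ i, ∀ t ≤ (0 : ℝ),
        x + t • e.symm (Pi.single i (1 : ℝ)) ∈ {y : E' | γ (y - ⟪y, u⟫_ℝ • u) < ⟪y, u⟫_ℝ} := by
  set n := finrank ℝ E' with hn_def
  have hu0 : u ≠ 0 := by
    rintro rfl; simp at hu
  have hn : 0 < n := by
    haveI : Nontrivial E' := ⟨⟨u, 0, hu0⟩⟩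
    exact finrank_pos
  set i₀ : Fin n := ⟨0, hn⟩
  -- an orthonormal basis containing `u`
  have hv : Orthonormal ℝ (({i₀} : Set (Fin n)).restrict fun _ : Fin n => u) := by
    refine ⟨fun i => by simpa using hu, fun i j hij => ?_⟩
    exact absurd (Subsingleton.elim i j) hij
  obtain ⟨b, hb⟩ := Orthonormal.exists_orthonormalBasis_extension_of_card_eq
    (𝕜 := ℝ) (E := E') (by simp [n]) hv
  have hbu : b i₀ = u := hb i₀ rfl
  have huu : ⟪u, u⟫_ℝ = 1 := by
    rw [real_inner_self_eq_norm_sq, hu, one_pow]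
  have hbiu : ∀ i, ⟪b i, u⟫_ℝ = if i = i₀ then 1 else 0 := by
    intro i
    rw [← hbu]
    exact orthonormal_iff_ite.1 b.orthonormal i i₀
  -- the cone basis `w i = -(b i + c • u)`, `c = K + 1`
  set c : ℝ := (K : ℝ) + 1 with hc_def
  have hc0 : 0 < c := by positivity
  set w : Fin n → E' := fun i => -(b i + c • u) with hw_def
  have hli : LinearIndependent ℝ w := by
    rw [Fintype.linearIndependent_iff]
    intro g hg
    set S := ∑ i, g i with hS_def
    have h0 : ∑ i, g i • (b i + c • u) = 0 := by
      have : ∀ i, g i • w i = -(g i • (b i + c • u)) := fun i => by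
        simp only [hw_def, smul_neg]
      simp_rw [this, Finset.sum_neg_distrib, neg_eq_zero] at hg
      exact hg
    -- `Σ gᵢ bᵢ = -(S c) • u`
    have h1 : ∑ i, g i • b i = -((S * c) • u) := by
      rw [eq_neg_iff_add_eq_zero, ← h0, hS_def, mul_smul, Finset.sum_smul,
        ← Finset.sum_add_distrib]
      exact Finset.sum_congr rfl fun i _ => by rw [smul_add]
    -- coefficients: `g j = -(S c) ⟪b i₀, b j⟫`
    have h2 : ∀ j, g j = -(S * c) * (if i₀ = j then 1 else 0) := by
      intro j
      have := b.orthonormal.inner_left_fintype g j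
      simp only [conj_trivial] at this
      rw [← this, h1, inner_neg_left, real_inner_smul_left, ← hbu,
        orthonormal_iff_ite.1 b.orthonormal i₀ j]
      ring
    have h3 : S = -(S * c) := by
      conv_lhs => rw [hS_def]
      rw [Finset.sum_congr rfl fun j (_ : j ∈ Finset.univ) => h2 j]
      simp
    have hS0 : S = 0 := by
      have h4 : S * (1 + c) = 0 := by linarith
      exact (mul_eq_zero.1 h4).resolve_right (by positivity)
    intro i
    rw [h2 i, hS0]
    simp
  haveI : Nonempty (Fin n) := ⟨i₀⟩
  let B : Module.Basis (Fin n) ℝ E' := basisOfLinearIndependentOfCardEqFinrank hli (by simp [n])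
  have hB : ∀ i, B i = w i := fun i => by
    simp [B]
  refine ⟨B.equivFun.toContinuousLinearEquiv, fun x hx i t ht => ?_⟩
  have hsymm : B.equivFun.toContinuousLinearEquiv.symm (Pi.single i (1 : ℝ)) = w i := by
    simp [hB]
  rw [hsymm]
  simp only [mem_setOf_eq] at hx ⊢
  -- the point `y = x + s • (b i + c • u)`, `s = -t ≥ 0`
  set s : ℝ := -t with hs_def
  have hs : 0 ≤ s := by linarith
  have hy : x + t • w i = x + s • (b i + c • u) := by
    simp only [hw_def, hs_def, smul_neg, neg_smul]
  rw [hy]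
  -- heights and projections
  have hheight : ⟪x + s • (b i + c • u), u⟫_ℝ = ⟪x, u⟫_ℝ + s * (⟪b i, u⟫_ℝ + c) := by
    simp only [inner_add_left, inner_smul_left, huu, conj_trivial]
    ring
  have hP : x + s • (b i + c • u) - ⟪x + s • (b i + c • u), u⟫_ℝ • u =
      (x - ⟪x, u⟫_ℝ • u) + s • (b i - ⟪b i, u⟫_ℝ • u) := by
    rw [hheight]
    module
  have hbi1 : -1 ≤ ⟪b i, u⟫_ℝ := by
    have h := abs_real_inner_le_norm (b i) u
    rw [b.orthonormal.1 i, hu, one_mul] at h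
    exact neg_le_of_abs_le h
  have hPn : ‖s • (b i - ⟪b i, u⟫_ℝ • u)‖ ≤ s := by
    rw [norm_smul, Real.norm_of_nonneg hs]
    calc s * ‖b i - ⟪b i, u⟫_ℝ • u‖ ≤ s * ‖b i‖ := by
          gcongr; exact SobolevApprox.norm_sub_inner_smul_le hu (b i)
      _ = s := by rw [b.orthonormal.1 i, mul_one]
  have hγle : γ (x + s • (b i + c • u) - ⟪x + s • (b i + c • u), u⟫_ℝ • u) ≤
      γ (x - ⟪x, u⟫_ℝ • u) + K * s := by
    rw [hP]
    have h := hγ.dist_le_mul ((x - ⟪x, u⟫_ℝ • u) + s • (b i - ⟪b i, u⟫_ℝ • u)) (x - ⟪x, u⟫_ℝ • u)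
    rw [Real.dist_eq, dist_eq_norm, add_sub_cancel_left] at h
    have h' := (le_abs_self _).trans h
    nlinarith [hPn, K.coe_nonneg]
  calc γ (x + s • (b i + c • u) - ⟪x + s • (b i + c • u), u⟫_ℝ • u)
      ≤ γ (x - ⟪x, u⟫_ℝ • u) + K * s := hγle
    _ < ⟪x, u⟫_ℝ + K * s := by linarith
    _ ≤ ⟪x + s • (b i + c • u), u⟫_ℝ := by
        rw [hheight, hc_def]; nlinarith [hbi1, hs, K.coe_nonneg]

end Cone


/-! ### `L^q` norms of functions supported in a chart ball -/

section Support

variable {X : Type*} [MeasurableSpace X] {ν : Measure X} {G : Type*} [NormedAddCommGroup G]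

/-- If `f` is supported in a measurable set `B` on which two sets `s`, `s'` have the same trace,
then the `L^q` norms of `f` over `s` and over `s'` agree. [folklore] -/
theorem eLpNorm_restrict_eq_of_support_subset_of_inter_eq {f : X → G} {B s s' : Set X}
    (hB : MeasurableSet B) (hf : support f ⊆ B) (h : s ∩ B = s' ∩ B) (q : ℝ≥0∞) :
    eLpNorm f q (ν.restrict s) = eLpNorm f q (ν.restrict s') := by
  rw [← eLpNorm_restrict_eq_of_support_subset (μ := ν.restrict s) hf,
    ← eLpNorm_restrict_eq_of_support_subset (μ := ν.restrict s') hf,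
    Measure.restrict_restrict hB, Measure.restrict_restrict hB, inter_comm B s, inter_comm B s', h]

end Support

/-! ### The inequality for smooth functions on a bounded Lipschitz domain -/

section Smooth

variable {E' : Type*} [NormedAddCommGroup E'] [InnerProductSpace ℝ E'] [FiniteDimensional ℝ E']
  [MeasurableSpace E'] [BorelSpace E'] (μ : Measure E') [μ.IsAddHaarMeasure]
variable {F : Type*} [NormedAddCommGroup F] [NormedSpace ℝ F]

/-- **Boundary patch.** If inside `B(x₀, r)` the open set `Ω` is the strict epigraph of a
Lipschitz function (`IsLipschitzGraphNear Ω x₀ r`), `1 ≤ p`, `p'⁻¹ = p⁻¹ - n⁻¹`, then there is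
`C` with `‖ψ‖_{L^{p'}(Ω)} ≤ C ‖Dψ‖_{L^p(Ω)}` for every `ψ ∈ C¹_c(E'; F)` supported in `B(x₀, r)`:
the norms over `Ω` are norms over the epigraph `U` (which agrees with `Ω` on the ball), and on
`U` this is the Gagliardo–Nirenberg–Sobolev inequality on a coordinate-lower set in the
cone-adapted coordinates of `exists_equiv_forall_add_smul_mem_epigraph` (Adams, *Sobolev
Spaces* (1975), Lemma 5.10). [cite: Adams1975, Lemma 5.10] -/
theorem exists_eLpNorm_le_of_isLipschitzGraphNear {Ω : Opens E'} {x₀ : E'} {r : ℝ}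
    (hΩ : IsLipschitzGraphNear Ω x₀ r) {p p' : ℝ≥0} (hp : 1 ≤ p) (hn : 0 < finrank ℝ E')
    (hp' : (p' : ℝ)⁻¹ = p⁻¹ - (finrank ℝ E' : ℝ)⁻¹) :
    ∃ C : ℝ≥0, ∀ ψ : E' → F, ContDiff ℝ 1 ψ → HasCompactSupport ψ → tsupport ψ ⊆ ball x₀ r →
      eLpNorm ψ p' (μ.restrict Ω) ≤ C * eLpNorm (fderiv ℝ ψ) p (μ.restrict Ω) := by
  obtain ⟨u, hu, γ, K, hγ, hΩr⟩ := hΩ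
  set U : Set E' := {y | γ (y - ⟪y, u⟫_ℝ • u) < ⟪y, u⟫_ℝ} with hU_def
  have hUo : IsOpen U := by
    have hc : Continuous fun y : E' => γ (y - ⟪y, u⟫_ℝ • u) :=
      hγ.continuous.comp (continuous_id.sub ((continuous_id.inner continuous_const).smul
        continuous_const))
    exact isOpen_lt hc (continuous_id.inner continuous_const)
  obtain ⟨e, he⟩ := exists_equiv_forall_add_smul_mem_epigraph hu hγ
  obtain ⟨C, hC⟩ := exists_eLpNorm_restrict_le_mul_eLpNorm_restrict_fderiv (F := F) μ e
    hUo.measurableSet he hp hn hp'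
  refine ⟨C, fun ψ hψ h2ψ hψs => ?_⟩
  have hΩU : (Ω : Set E') ∩ ball x₀ r = U ∩ ball x₀ r := by
    rw [hΩr]
    ext y
    simp only [mem_setOf_eq, mem_inter_iff, hU_def]
    tauto
  have h1 : support ψ ⊆ ball x₀ r := (subset_tsupport ψ).trans hψs
  have h2 : support (fderiv ℝ ψ) ⊆ ball x₀ r := (support_fderiv_subset ℝ).trans hψs
  rw [eLpNorm_restrict_eq_of_support_subset_of_inter_eq isOpen_ball.measurableSet h1 hΩU,
    eLpNorm_restrict_eq_of_support_subset_of_inter_eq isOpen_ball.measurableSet h2 hΩU]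
  exact hC ψ hψ h2ψ

/-- **Interior patch.** For `ψ ∈ C¹_c(E'; F)` supported in `Ω`, the norms over `Ω` are norms
over `E'`, and `‖ψ‖_{L^{p'}(Ω)} ≤ C ‖Dψ‖_{L^p(Ω)}` is the whole-space Gagliardo–Nirenberg–Sobolev
inequality `Literature.Analysis.FunctionSpaces.eLpNorm_le_mul_eLpNorm_fderiv_of_eq` (Adams, *Sobolev Spaces* (1975), 5.11,
Sobolev's inequality (21); Evans, *PDE*, §5.6.1, Theorem 1). [cite: Adams1975, 5.11 inequality (21)] -/
theorem exists_eLpNorm_le_of_tsupport_subset (Ω : Opens E') {p p' : ℝ≥0}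
    (hp : 1 ≤ p) (hn : 0 < finrank ℝ E') (hp' : (p' : ℝ)⁻¹ = p⁻¹ - (finrank ℝ E' : ℝ)⁻¹) :
    ∃ C : ℝ≥0, ∀ ψ : E' → F, ContDiff ℝ 1 ψ → HasCompactSupport ψ →
      tsupport ψ ⊆ (Ω : Set E') →
      eLpNorm ψ p' (μ.restrict Ω) ≤ C * eLpNorm (fderiv ℝ ψ) p (μ.restrict Ω) := by
  refine ⟨eLpNormLESNormFDerivOfEqInnerConst μ p, fun ψ hψ h2ψ hψs => ?_⟩
  have h1 : support ψ ⊆ (Ω : Set E') := (subset_tsupport ψ).trans hψs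
  have h2 : support (fderiv ℝ ψ) ⊆ (Ω : Set E') := (support_fderiv_subset ℝ).trans hψs
  rw [eLpNorm_restrict_eq_of_support_subset h1]
  refine (eLpNorm_le_mul_eLpNorm_fderiv_of_eq μ hψ h2ψ hp hn hp').trans_eq ?_
  rw [← eLpNorm_norm (fderiv ℝ ψ), ← eLpNorm_norm (fderiv ℝ ψ),
    eLpNorm_restrict_eq_of_support_subset]
  intro x hx
  exact h2 (by simpa using hx)

/-- **The Sobolev inequality for smooth functions on a bounded Lipschitz domain** (Adams,
*Sobolev Spaces* (1975), Lemma 5.10, inequality (18) `‖u‖_{0,q,Ω} ≤ K ‖u‖_{1,p,Ω}`,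
`q = np/(n-p)`, for `u ∈ C^∞(Ω̄)`; = Adams–Fournier (2003), Thm. 4.12, Part I, Case C, `m = 1`).
For a bounded Lipschitz domain `Ω`, `1 ≤ p`, `p'⁻¹ = p⁻¹ - n⁻¹` and an additive Haar measure
`μ` there is `C` with `‖φ‖_{L^{p'}(Ω)} ≤ C (‖φ‖_{L^p(Ω)} + ‖Dφ‖_{L^p(Ω)})` for every
`φ ∈ C¹(E'; F)`. Proof: a smooth partition of unity `(ρᵢ)` on `Ω̄` subordinate to the cover by
`Ω` and the half-balls of finitely many Lipschitz charts (as in the density theorem, Adams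
Thm. 3.18); `φ = Σ ρᵢ φ` on `Ω`, each piece is estimated by the interior / boundary patch
inequality, and `‖D(ρᵢ φ)‖_{L^p(Ω)} ≤ ‖Dφ‖_{L^p(Ω)} + sup ‖Dρᵢ‖ ‖φ‖_{L^p(Ω)}`. [cite: Adams1975, Lemma 5.10] [cite: AdamsFournier2003, Thm. 4.12 Part I Case C (m = 1)] -/
theorem exists_eLpNorm_le_add_of_contDiff {Ω : Opens E'} (hΩ : IsLipschitzDomain Ω)
    (hb : IsBounded (Ω : Set E')) {p p' : ℝ≥0} (hp : 1 ≤ p) (hn : 0 < finrank ℝ E')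
    (hp' : (p' : ℝ)⁻¹ = p⁻¹ - (finrank ℝ E' : ℝ)⁻¹) :
    ∃ C : ℝ≥0, ∀ φ : E' → F, ContDiff ℝ 1 φ →
      eLpNorm φ p' (μ.restrict Ω) ≤
        C * (eLpNorm φ p (μ.restrict Ω) + eLpNorm (fderiv ℝ φ) p (μ.restrict Ω)) := by
  -- trivial when `p' = 0`
  by_cases hp'0 : p' = 0
  · exact ⟨0, fun φ _ => by simp [hp'0]⟩
  have hp'1 : (1 : ℝ≥0∞) ≤ p' := by
    have hp'pos : (0 : ℝ) < p' := NNReal.coe_pos.2 (pos_iff_ne_zero.2 hp'0)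
    have h1 : (p' : ℝ)⁻¹ ≤ 1 := by
      rw [hp']
      calc (p : ℝ)⁻¹ - (finrank ℝ E' : ℝ)⁻¹ ≤ (p : ℝ)⁻¹ := sub_le_self _ (by positivity)
        _ ≤ 1 := inv_le_one_of_one_le₀ (by exact_mod_cast hp)
    have h2 : (1 : ℝ) ≤ p' := (inv_le_one₀ hp'pos).1 h1
    exact_mod_cast h2
  have hp1 : (1 : ℝ≥0∞) ≤ p := by exact_mod_cast hp
  have hΩm : MeasurableSet (Ω : Set E') := Ω.isOpen.measurableSet
  set ν := μ.restrict (Ω : Set E') with hν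
  -- Lipschitz charts at the boundary points
  choose! r hr hchart using hΩ
  -- the compact boundary is covered by finitely many half-balls of charts
  have hK : IsCompact (frontier (Ω : Set E')) :=
    hb.isCompact_closure.of_isClosed_subset isClosed_frontier frontier_subset_closure
  obtain ⟨t, htf, hcover⟩ := hK.elim_nhds_subcover (fun x => ball x (r x / 2))
    fun x hx => ball_mem_nhds x (half_pos (hr x hx))
  -- the open cover of `closure Ω` indexed by `Option t`: `Ω` itself and the half-balls
  let V : Option t → Set E' := fun i => i.elim (Ω : Set E') fun x => ball (x : E') (r x / 2)
  have hVo : ∀ i, IsOpen (V i) := by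
    rintro (_ | ⟨x, hx⟩)
    exacts [Ω.isOpen, isOpen_ball]
  have hVb : ∀ i, IsBounded (V i) := by
    rintro (_ | ⟨x, hx⟩)
    exacts [hb, isBounded_ball]
  have hVc : closure (Ω : Set E') ⊆ ⋃ i, V i := by
    intro y hy
    rw [closure_eq_self_union_frontier] at hy
    rcases hy with hy | hy
    · exact mem_iUnion.2 ⟨none, hy⟩
    · obtain ⟨x, hxt, hyx⟩ := mem_iUnion₂.1 (hcover hy)
      exact mem_iUnion.2 ⟨some ⟨x, hxt⟩, hyx⟩
  obtain ⟨ρ, hρ⟩ := SmoothPartitionOfUnity.exists_isSubordinate (I := 𝓘(ℝ, E')) (M := E')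
    isClosed_closure V hVo hVc
  have hρs : ∀ i, ContDiff ℝ ∞ (ρ i) := fun i => contMDiff_iff_contDiff.1 (ρ i).contMDiff
  have hρc : ∀ i, HasCompactSupport (ρ i) := fun i =>
    Metric.isCompact_of_isClosed_isBounded (isClosed_tsupport _) ((hVb i).subset (hρ i))
  have hρ1 : ∀ i, ContDiff ℝ 1 (ρ i) := fun i => (hρs i).of_le (by exact_mod_cast le_top)
  -- per-patch Gagliardo–Nirenberg–Sobolev constants
  have hpatch : ∀ i, ∃ C : ℝ≥0, ∀ ψ : E' → F, ContDiff ℝ 1 ψ → HasCompactSupport ψ →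
      tsupport ψ ⊆ V i → eLpNorm ψ p' ν ≤ C * eLpNorm (fderiv ℝ ψ) p ν := by
    rintro (_ | ⟨x₀, hx₀⟩)
    · exact exists_eLpNorm_le_of_tsupport_subset μ Ω hp hn hp'
    · obtain ⟨C, hC⟩ :=
        exists_eLpNorm_le_of_isLipschitzGraphNear (F := F) μ (hchart x₀ (htf x₀ hx₀)) hp hn hp'
      exact ⟨C, fun ψ hψ h2ψ hψs => hC ψ hψ h2ψ
        (hψs.trans (ball_subset_ball (by linarith [hr x₀ (htf x₀ hx₀)])))⟩
  choose C hC using hpatch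
  -- bounds for the derivatives of the partition functions
  have hA : ∀ i, ∃ A : ℝ≥0, ∀ x, ‖fderiv ℝ (ρ i) x‖ ≤ A := by
    intro i
    obtain ⟨A, hA⟩ := ((hρ1 i).continuous_fderiv one_ne_zero).bounded_above_of_compact_support
      ((hρc i).fderiv (𝕜 := ℝ))
    exact ⟨A.toNNReal, fun x => (hA x).trans (Real.le_coe_toNNReal A)⟩
  choose A hA using hA
  refine ⟨∑ i, C i * (1 + A i), fun φ hφ => ?_⟩
  -- the pieces `ψ i = ρ i • φ`
  set ψ : Option t → E' → F := fun i x => ρ i x • φ x with hψ_def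
  have hψ1 : ∀ i, ContDiff ℝ 1 (ψ i) := fun i => (hρ1 i).smul hφ
  have hψc : ∀ i, HasCompactSupport (ψ i) := fun i => (hρc i).smul_right
  have hψs : ∀ i, tsupport (ψ i) ⊆ V i := fun i => (tsupport_smul_subset_left _ _).trans (hρ i)
  -- `φ = Σ ψ i` on `Ω`
  have hsum : ∀ x ∈ (Ω : Set E'), φ x = ∑ i, ψ i x := fun x hx => by
    have h1 := ρ.sum_eq_one (subset_closure hx)
    rw [finsum_eq_sum_of_fintype] at h1
    simp only [hψ_def, ← Finset.sum_smul, h1, one_smul]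
  -- derivative of the pieces
  have hDψ : ∀ i x, ‖fderiv ℝ (ψ i) x‖ ≤ ‖fderiv ℝ φ x‖ + A i * ‖φ x‖ := by
    intro i x
    rw [show ψ i = fun x => ρ i x • φ x from rfl,
      fderiv_fun_smul ((hρ1 i).differentiable one_ne_zero x) (hφ.differentiable one_ne_zero x)]
    calc ‖ρ i x • fderiv ℝ φ x + (fderiv ℝ (ρ i) x).smulRight (φ x)‖
        ≤ ‖ρ i x • fderiv ℝ φ x‖ + ‖(fderiv ℝ (ρ i) x).smulRight (φ x)‖ := norm_add_le _ _
      _ ≤ ‖fderiv ℝ φ x‖ + A i * ‖φ x‖ := by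
          rw [norm_smul, ContinuousLinearMap.norm_smulRight_apply,
            Real.norm_of_nonneg (ρ.nonneg i x)]
          gcongr
          · exact mul_le_of_le_one_left (norm_nonneg _) (ρ.le_one i x)
          · exact hA i x
  -- measurability
  have hφm : AEStronglyMeasurable φ ν := hφ.continuous.aestronglyMeasurable
  have hDφm : AEStronglyMeasurable (fderiv ℝ φ) ν :=
    (hφ.continuous_fderiv one_ne_zero).aestronglyMeasurable
  -- `L^p` bound for the derivatives of the pieces
  have hDψp : ∀ i, eLpNorm (fderiv ℝ (ψ i)) p ν ≤
      eLpNorm (fderiv ℝ φ) p ν + A i * eLpNorm φ p ν := by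
    intro i
    calc eLpNorm (fderiv ℝ (ψ i)) p ν
        ≤ eLpNorm (fun x => ‖fderiv ℝ φ x‖ + A i * ‖φ x‖) p ν := eLpNorm_mono_real (hDψ i)
      _ ≤ eLpNorm (fun x => ‖fderiv ℝ φ x‖) p ν + eLpNorm (fun x => (A i : ℝ) * ‖φ x‖) p ν :=
          eLpNorm_add_le (f := fun x => ‖fderiv ℝ φ x‖) (g := fun x => (A i : ℝ) * ‖φ x‖)
            hDφm.norm (hφm.norm.const_mul _) hp1
      _ = eLpNorm (fderiv ℝ φ) p ν + A i * eLpNorm φ p ν := by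
          rw [eLpNorm_norm]
          congr 1
          rw [show (fun x => (A i : ℝ) * ‖φ x‖) = (A i : ℝ) • fun x => ‖φ x‖ from rfl,
            eLpNorm_const_smul, eLpNorm_norm]
          simp
  -- assemble
  have hkey : ∀ i, eLpNorm (ψ i) p' ν ≤
      (C i * (1 + A i) : ℝ≥0) * (eLpNorm φ p ν + eLpNorm (fderiv ℝ φ) p ν) := by
    intro i
    calc eLpNorm (ψ i) p' ν ≤ C i * eLpNorm (fderiv ℝ (ψ i)) p ν :=
          hC i (ψ i) (hψ1 i) (hψc i) (hψs i)
      _ ≤ C i * (eLpNorm (fderiv ℝ φ) p ν + A i * eLpNorm φ p ν) := by gcongr; exact hDψp i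
      _ ≤ C i * ((1 + A i) * (eLpNorm φ p ν + eLpNorm (fderiv ℝ φ) p ν)) := by
          gcongr
          rw [add_mul, one_mul, mul_add]
          calc eLpNorm (fderiv ℝ φ) p ν + A i * eLpNorm φ p ν
              ≤ (eLpNorm φ p ν + eLpNorm (fderiv ℝ φ) p ν) + (A i * eLpNorm φ p ν + 0) := by
                rw [add_zero]; exact add_le_add le_add_self le_rfl
            _ ≤ (eLpNorm φ p ν + eLpNorm (fderiv ℝ φ) p ν) +
                (A i * eLpNorm φ p ν + A i * eLpNorm (fderiv ℝ φ) p ν) := by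
                gcongr; exact zero_le
      _ = (C i * (1 + A i) : ℝ≥0) * (eLpNorm φ p ν + eLpNorm (fderiv ℝ φ) p ν) := by
          push_cast; ring
  calc eLpNorm φ p' ν = eLpNorm (∑ i, ψ i) p' ν := by
        refine eLpNorm_congr_ae (ae_restrict_of_forall_mem hΩm fun x hx => ?_)
        rw [hsum x hx, Finset.sum_apply]
    _ ≤ ∑ i, eLpNorm (ψ i) p' ν :=
        eLpNorm_sum_le (fun i _ => (hψ1 i).continuous.aestronglyMeasurable) hp'1
    _ ≤ ∑ i, ((C i * (1 + A i) : ℝ≥0) : ℝ≥0∞) * (eLpNorm φ p ν + eLpNorm (fderiv ℝ φ) p ν) :=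
        Finset.sum_le_sum fun i _ => hkey i
    _ = ((∑ i, C i * (1 + A i) : ℝ≥0) : ℝ≥0∞) * (eLpNorm φ p ν + eLpNorm (fderiv ℝ φ) p ν) := by
        rw [← Finset.sum_mul, ENNReal.ofNNReal_finsetSum]

end Smooth

/-! ### The discharge -/

section Discharge

variable {E' : Type*} [NormedAddCommGroup E'] [NormedSpace ℝ E'] [MeasurableSpace E']
  [FiniteDimensional ℝ E']
variable {F : Type*} [NormedAddCommGroup F] [NormedSpace ℝ F]

/-- Unfolding the `W^{1,p}` norm: `‖h‖_{W^{1,p}} = ‖h‖_{L^p} + inf_{g'} Σᵢ ‖g' bᵢ‖_{L^p}`.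
[folklore] -/
private theorem eSobolevDomainNorm_one' {p : ℝ≥0∞} {Ω : Opens E'} {μ : Measure E'}
    {h : E' → F} :
    eSobolevDomainNorm 1 p Ω μ h = eLpNorm h p (μ.restrict Ω) +
      ⨅ (g' : E' → E' →L[ℝ] F) (_ : HasWeakFDerivOn Ω μ h g'),
        ∑ i, eLpNorm (fun x => g' x (Module.finBasis ℝ E' i)) p (μ.restrict Ω) := by
  simp [eSobolevDomainNorm]

/-- Convergence `φₖ → f` in `W^{1,p}(Ω)` of `C¹` functions forces `Dφₖ → g` in `L^p(Ω)` for any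
weak derivative `g` of `f` on `Ω` — the variant of
`Literature.Analysis.FunctionSpaces.tendsto_eLpNorm_fderiv_of_tendsto_eSobolevDomainNorm` (stated there for test functions)
for approximants merely `C¹` on `E'`, with the same proof: the derivative part of
`‖f - φₖ‖_{W^{1,p}}` is an infimum over weak derivatives of `f - φₖ`, all a.e. equal to
`g - Dφₖ` (`HasWeakFDerivOn.unique_holds`, `HasWeakFDerivOn.of_contDiff_holds`), and the
operator norm is controlled by the values on a basis. (Adams, *Sobolev Spaces* (1975), proof of
Lemma 5.10: "(18) extends by continuity to all of `W^{1,p}(Ω)`".) [cite: Adams1975, Lemma 5.10 (proof, last paragraph)] -/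
theorem tendsto_eLpNorm_fderiv_of_tendsto_eSobolevDomainNorm_of_contDiff [BorelSpace E']
    [CompleteSpace F] {p : ℝ≥0∞} (hp : 1 ≤ p) {Ω : Opens E'} {μ : Measure E'} [μ.IsAddHaarMeasure]
    {f : E' → F}
    {g : E' → E' →L[ℝ] F} (hfg : HasWeakFDerivOn Ω μ f g) {φ : ℕ → E' → F}
    (hφ : ∀ k, ContDiff ℝ 1 (φ k))
    (hlim : Tendsto (fun k => eSobolevDomainNorm 1 p Ω μ (f - φ k)) atTop (𝓝 0)) :
    Tendsto (fun k => eLpNorm (fun x => g x - fderiv ℝ (φ k) x) p (μ.restrict Ω)) atTop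
      (𝓝 0) := by
  set b := Module.finBasis ℝ E'
  obtain ⟨Cb, hCb0, hCb⟩ := exists_opNorm_le_mul_sum_basis (F := F) b
  -- the derivative part of the Sobolev norm tends to zero
  set I : ℕ → ℝ≥0∞ := fun k => ⨅ (g' : E' → E' →L[ℝ] F) (_ : HasWeakFDerivOn Ω μ (f - φ k) g'),
    ∑ i, eLpNorm (fun x => g' x (b i)) p (μ.restrict Ω) with hI_def
  have hI : Tendsto I atTop (𝓝 0) := by
    refine tendsto_of_tendsto_of_tendsto_of_le_of_le tendsto_const_nhds hlim (fun _ => zero_le)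
      fun k => ?_
    rw [eSobolevDomainNorm_one']
    exact le_add_self
  -- each admissible `g'` is a.e. `g - Dφₖ`
  have hkey : ∀ k, eLpNorm (fun x => g x - fderiv ℝ (φ k) x) p (μ.restrict Ω) ≤ Cb * I k := by
    intro k
    have hφk : HasWeakFDerivOn Ω μ (φ k) (fderiv ℝ (φ k)) :=
      HasWeakFDerivOn.of_contDiff_holds Ω μ (hφ k)
    have hd : HasWeakFDerivOn Ω μ (f - φ k) (g - fderiv ℝ (φ k)) := hfg.sub hφk
    have h1 : ∀ g', HasWeakFDerivOn Ω μ (f - φ k) g' →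
        eLpNorm (fun x => g x - fderiv ℝ (φ k) x) p (μ.restrict Ω) ≤
          Cb * ∑ i, eLpNorm (fun x => g' x (b i)) p (μ.restrict Ω) := by
      intro g' hg'
      have hae : g' =ᵐ[μ.restrict Ω] (g - fderiv ℝ (φ k)) := HasWeakFDerivOn.unique_holds hg' hd
      calc eLpNorm (fun x => g x - fderiv ℝ (φ k) x) p (μ.restrict Ω)
          = eLpNorm g' p (μ.restrict Ω) := (eLpNorm_congr_ae hae).symm
        _ ≤ Cb * ∑ i, eLpNorm (fun x => g' x (b i)) p (μ.restrict Ω) :=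
          eLpNorm_le_mul_sum_eLpNorm_apply_basis b hCb
            hg'.locallyIntegrableOn_deriv.aestronglyMeasurable hp
    calc eLpNorm (fun x => g x - fderiv ℝ (φ k) x) p (μ.restrict Ω)
        ≤ ⨅ (g' : E' → E' →L[ℝ] F) (_ : HasWeakFDerivOn Ω μ (f - φ k) g'),
            Cb * ∑ i, eLpNorm (fun x => g' x (b i)) p (μ.restrict Ω) := le_iInf₂ h1
      _ = Cb * I k := by
        simp only [hI_def]
        rw [ENNReal.mul_iInf_of_ne (by exact_mod_cast hCb0) ENNReal.coe_ne_top]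
        refine iInf_congr fun g' => ?_
        rw [ENNReal.mul_iInf_of_ne (by exact_mod_cast hCb0) ENNReal.coe_ne_top]
  have hCI : Tendsto (fun k => (Cb : ℝ≥0∞) * I k) atTop (𝓝 0) := by
    simpa using ENNReal.Tendsto.const_mul hI (Or.inr ENNReal.coe_ne_top)
  exact tendsto_of_tendsto_of_tendsto_of_le_of_le tendsto_const_nhds hCI (fun _ => zero_le) hkey

end Discharge

section Final

variable {E' : Type*} [NormedAddCommGroup E'] [InnerProductSpace ℝ E'] [MeasurableSpace E']
  [BorelSpace E']
variable {F : Type*} [NormedAddCommGroup F] [NormedSpace ℝ F] [CompleteSpace F]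

/-- **The Sobolev embedding on a bounded Lipschitz domain, quantitative form** (Adams, *Sobolev
Spaces* (1975), Lemma 5.10: `W^{1,p}(Ω) → L^q(Ω)`, `q = np/(n-p)`, `1 ≤ p < n`, i.e.
`‖u‖_{0,q,Ω} ≤ K ‖u‖_{1,p,Ω}` for all `u ∈ W^{1,p}(Ω)`, for bounded domains with the cone
property; = Adams–Fournier (2003), Thm. 4.12, Part I, Case C, `m = 1`; Evans, *PDE*, §5.6.1,
Theorem 2 for `C¹` boundaries). For a bounded Lipschitz domain `Ω`, `1 ≤ p < n = dim E'`,
`p'⁻¹ = p⁻¹ - n⁻¹`, an additive Haar measure `μ` and complete `F` there is `C` such that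
`‖f‖_{L^{p'}(Ω)} ≤ C (‖f‖_{L^p(Ω)} + ‖g‖_{L^p(Ω)})` for every `f ∈ W^{1,p}(Ω; F)` and every weak
derivative `g` of `f` on `Ω`. Proof: the smooth case `exists_eLpNorm_le_add_of_contDiff`
extends by density of `C^∞(Ω̄)` (`smooth_upToBoundary_dense_one`) and Fatou's lemma along an
a.e. convergent subsequence. [cite: Adams1975, Lemma 5.10] [cite: AdamsFournier2003, Thm. 4.12 Part I Case C (m = 1)] -/
theorem exists_eLpNorm_le_of_memSobolevDomain_one [FiniteDimensional ℝ E'] {Ω : Opens E'}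
    (hΩ : IsLipschitzDomain Ω) (hb : IsBounded (Ω : Set E')) {p p' : ℝ≥0} (hp : 1 ≤ p)
    (hpn : (p : ℝ) < finrank ℝ E')
    (hp' : (p' : ℝ)⁻¹ = p⁻¹ - (finrank ℝ E' : ℝ)⁻¹) (μ : Measure E') [μ.IsAddHaarMeasure] :
    ∃ C : ℝ≥0, ∀ (f : E' → F) (g : E' → E' →L[ℝ] F), MemSobolevDomain 1 p Ω μ f →
      HasWeakFDerivOn Ω μ f g →
      eLpNorm f p' (μ.restrict Ω) ≤
        C * (eLpNorm f p (μ.restrict Ω) + eLpNorm g p (μ.restrict Ω)) := by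
  have hn : 0 < finrank ℝ E' := by
    have h : (0 : ℝ) < finrank ℝ E' := (p.coe_nonneg).trans_lt hpn
    exact_mod_cast h
  obtain ⟨C, hC⟩ := exists_eLpNorm_le_add_of_contDiff (F := F) μ hΩ hb hp hn hp'
  refine ⟨C, fun f g hf hg => ?_⟩
  have hp1 : (1 : ℝ≥0∞) ≤ p := by exact_mod_cast hp
  have hp0 : (p : ℝ≥0∞) ≠ 0 := (zero_lt_one.trans_le hp1).ne'
  set ν := μ.restrict (Ω : Set E') with hν
  obtain ⟨φ, hφ, hlim⟩ := smooth_upToBoundary_dense_one hΩ hb hp1 ENNReal.coe_ne_top μ hf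
  have hφ1 : ∀ k, ContDiff ℝ 1 (φ k) := fun k => (hφ k).of_le (by exact_mod_cast le_top)
  have hDlim := tendsto_eLpNorm_fderiv_of_tendsto_eSobolevDomainNorm_of_contDiff hp1 hg hφ1 hlim
  have hLp : Tendsto (fun k => eLpNorm (f - φ k) p ν) atTop (𝓝 0) :=
    tendsto_of_tendsto_of_tendsto_of_le_of_le tendsto_const_nhds hlim (fun _ => zero_le)
      fun _ => eLpNorm_le_eSobolevDomainNorm
  -- measurability
  have hfm : AEStronglyMeasurable f ν := hf.memLp.aestronglyMeasurable
  have hφm : ∀ k, AEStronglyMeasurable (φ k) ν := fun k =>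
    (hφ k).continuous.aestronglyMeasurable
  have hgm : AEStronglyMeasurable g ν := hg.locallyIntegrableOn_deriv.aestronglyMeasurable
  have hDφm : ∀ k, AEStronglyMeasurable (fderiv ℝ (φ k)) ν := fun k =>
    ((hφ1 k).continuous_fderiv one_ne_zero).aestronglyMeasurable
  -- a subsequence converging a.e. on `Ω`
  have hmeas : TendstoInMeasure ν φ atTop f := by
    refine tendstoInMeasure_of_tendsto_eLpNorm hp0 hφm hfm ?_
    simpa only [eLpNorm_sub_comm] using hLp
  obtain ⟨ns, hns, hae⟩ := hmeas.exists_seq_tendsto_ae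
  -- the smooth inequality along the sequence, and triangle inequalities
  set e₁ : ℕ → ℝ≥0∞ := fun k => eLpNorm (f - φ k) p ν with he₁
  set e₂ : ℕ → ℝ≥0∞ := fun k => eLpNorm (fun x => g x - fderiv ℝ (φ k) x) p ν with he₂
  have hbound : ∀ k, eLpNorm (φ k) p' ν ≤
      C * ((eLpNorm f p ν + e₁ k) + (eLpNorm g p ν + e₂ k)) := by
    intro k
    refine (hC (φ k) (hφ1 k)).trans ?_
    gcongr
    · calc eLpNorm (φ k) p ν = eLpNorm (f - (f - φ k)) p ν := by rw [sub_sub_cancel]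
        _ ≤ eLpNorm f p ν + e₁ k := eLpNorm_sub_le hfm (hfm.sub (hφm k)) hp1
    · calc eLpNorm (fderiv ℝ (φ k)) p ν
          = eLpNorm (g - fun x => g x - fderiv ℝ (φ k) x) p ν := by
            congr 1; funext x; simp
        _ ≤ eLpNorm g p ν + e₂ k := eLpNorm_sub_le hgm (hgm.sub (hDφm k)) hp1
  have hlimit : Tendsto (fun k => (C : ℝ≥0∞) *
      ((eLpNorm f p ν + e₁ (ns k)) + (eLpNorm g p ν + e₂ (ns k)))) atTop
      (𝓝 ((C : ℝ≥0∞) * ((eLpNorm f p ν + 0) + (eLpNorm g p ν + 0)))) := by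
    refine ENNReal.Tendsto.const_mul ?_ (Or.inr ENNReal.coe_ne_top)
    exact (tendsto_const_nhds.add (hLp.comp hns.tendsto_atTop)).add
      (tendsto_const_nhds.add (hDlim.comp hns.tendsto_atTop))
  rw [add_zero, add_zero] at hlimit
  -- Fatou
  calc eLpNorm f p' ν ≤ atTop.liminf fun k => eLpNorm (φ (ns k)) p' ν :=
        Lp.eLpNorm_lim_le_liminf_eLpNorm (fun k => hφm (ns k)) f hae
    _ ≤ atTop.liminf fun k => (C : ℝ≥0∞) *
        ((eLpNorm f p ν + e₁ (ns k)) + (eLpNorm g p ν + e₂ (ns k))) :=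
        liminf_le_liminf (Eventually.of_forall fun k => hbound (ns k))
    _ = C * (eLpNorm f p ν + eLpNorm g p ν) := hlimit.liminf_eq

/-- **Discharge of `sobolev_embedding_domain`** (Adams–Fournier, *Sobolev Spaces*, 2nd ed.
(2003), Thm. 4.12, Part I, Case C with `m = 1`; Adams (1975), Thm. 5.4 Part I Case A (4) /
Lemma 5.10; Evans, *PDE*, §5.6.1, Theorem 2 for `C¹` boundaries): on a bounded Lipschitz domain,
for `1 ≤ p < n = dim E'` and `p* = np/(n-p)`, `W^{1,p}(Ω) ⊆ L^{p*}(Ω)`. From the quantitative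
form `exists_eLpNorm_le_of_memSobolevDomain_one` (`1/p* = 1/p - 1/n`), the weak derivative of
`f ∈ W^{1,p}(Ω)` having all components, hence itself, in `L^p(Ω)`.

**On the hypotheses `[BorelSpace E']`, `[CompleteSpace F]`.** The named fact
`sobolev_embedding_domain` is a `def`, so of the section instances of `SobolevTrace` only those
used by its body became parameters: its proposition does *not* assume `BorelSpace E'`,
`FiniteDimensional ℝ E'` or `CompleteSpace F`. Finite dimension follows from `p < finrank ℝ E'`
and is derived here; but for a non-complete `F` every Bochner integral is `0`
(`MeasureTheory.integral_of_not_completeSpace`), `HasWeakFDerivOn` is vacuous, `W^{1,p}(Ω; F)`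
is all of `L^p(Ω; F)` and the inclusion in `L^{p*}(Ω)` is false, so the fact can only be
established in contexts carrying these instances, which is what this theorem does (the Borel
σ-algebra being likewise indispensable for weak derivatives to mean anything). The closed,
corrected statement is `memLp_of_memSobolevDomain_one` below.

**Scope.** Adams's statement is scalar-valued and an imbedding inequality
`‖u‖_{0,q,Ω} ≤ K ‖u‖_{1,p,Ω}`; here the codomain is any complete `F`, the inequality is
`exists_eLpNorm_le_of_memSobolevDomain_one`, and the containment proved here is equivalent to
the imbedding by the closed-graph remark of Adams ¶5.2. [cite: AdamsFournier2003, Thm. 4.12 Part I Case C (m = 1)] [cite: Adams1975, Thm. 5.4 Part I Case A (4) and Lemma 5.10] -/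
theorem sobolev_embedding_domain_holds : sobolev_embedding_domain (E' := E') (F := F) := by
  intro Ω hΩ hb p hp hpd μ _ f hf
  have hp0 : 0 ≤ p := zero_le_one.trans hp
  lift p to ℝ≥0 using hp0
  set n := finrank ℝ E' with hn_def
  have hp1 : (1 : ℝ≥0) ≤ p := by exact_mod_cast hp
  have hnp : (0 : ℝ) < n - p := sub_pos.2 hpd
  have hn0 : (0 : ℝ) < n := (p.coe_nonneg).trans_lt hpd
  have hpp : (0 : ℝ) < p := zero_lt_one.trans_le hp
  haveI : FiniteDimensional ℝ E' := Module.finite_of_finrank_pos (by exact_mod_cast hn0)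
  -- the Sobolev conjugate exponent as an element of `ℝ≥0`
  set p' : ℝ≥0 := ((n : ℝ) * p / (n - p)).toNNReal with hp'_def
  have hp'c : ((p' : ℝ≥0) : ℝ) = (n : ℝ) * p / (n - p) :=
    Real.coe_toNNReal _ (by positivity)
  have hp' : (p' : ℝ)⁻¹ = (p : ℝ)⁻¹ - (finrank ℝ E' : ℝ)⁻¹ := by
    rw [hp'c, ← hn_def]
    field_simp
  have hofp : ENNReal.ofReal (p : ℝ) = (p : ℝ≥0∞) := ENNReal.ofReal_coe_nnreal
  have hofp' : ENNReal.ofReal ((finrank ℝ E' : ℝ) * p / (finrank ℝ E' - p)) = (p' : ℝ≥0∞) := by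
    rw [hp'_def, hn_def]
    rfl
  rw [hofp] at hf
  rw [hofp']
  obtain ⟨C, hC⟩ := exists_eLpNorm_le_of_memSobolevDomain_one (F := F) hΩ hb hp1 hpd hp' μ
  obtain ⟨hf0, g, hg, hgp⟩ := (memSobolevDomain_succ_iff (k := 0)).1 hf
  simp only [memSobolevDomain_zero_iff] at hgp
  have hp1' : (1 : ℝ≥0∞) ≤ p := by exact_mod_cast hp1
  -- the weak derivative is in `L^p(Ω)`
  have hgtop : eLpNorm g p (μ.restrict Ω) < ⊤ := by
    set b := Module.finBasis ℝ E'
    obtain ⟨Cb, -, hCb⟩ := exists_opNorm_le_mul_sum_basis (F := F) b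
    refine (eLpNorm_le_mul_sum_eLpNorm_apply_basis b hCb
      hg.locallyIntegrableOn_deriv.aestronglyMeasurable hp1').trans_lt ?_
    refine ENNReal.mul_lt_top ENNReal.coe_lt_top ?_
    exact ENNReal.sum_lt_top.2 fun i _ => (hgp (b i)).eLpNorm_lt_top
  refine ⟨hf0.aestronglyMeasurable, (hC f g hf hg).trans_lt ?_⟩
  exact ENNReal.mul_lt_top ENNReal.coe_lt_top
    (ENNReal.add_lt_top.2 ⟨hf0.eLpNorm_lt_top, hgtop⟩)

/-- **The Sobolev embedding `W^{1,p}(Ω) ⊆ L^{p*}(Ω)` on a bounded Lipschitz domain, corrected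
closed statement** (Adams–Fournier, *Sobolev Spaces*, 2nd ed. (2003), Thm. 4.12, Part I, Case C,
`m = 1`; Adams (1975), Lemma 5.10): for a finite-dimensional real inner product space `E'` with
its Borel σ-algebra, a bounded Lipschitz domain `Ω`, `1 ≤ p < n = dim E'`, an additive Haar
measure `μ` and a *complete* `F`, every `f ∈ W^{1,p}(Ω; F)` lies in `L^{np/(n-p)}(Ω; F)`. This is
the statement intended by the named fact `sobolev_embedding_domain`, with the hypotheses
`[BorelSpace E']` and `[CompleteSpace F]` that its `def` dropped made explicit (see
`sobolev_embedding_domain_holds`; codomain any complete `F`, containment ⇔ imbedding by the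
closed-graph remark of Adams ¶5.2). It is also the content of the corrected named fact
`sobolev_embedding_domain'` of `SobolevTrace`, discharged below. [cite: AdamsFournier2003, Thm. 4.12 Part I Case C (m = 1)] [cite: Adams1975, Thm. 5.4 Part I Case A (4) and Lemma 5.10] -/
theorem memLp_of_memSobolevDomain_one {Ω : Opens E'} (hΩ : IsLipschitzDomain Ω)
    (hb : IsBounded (Ω : Set E')) {p : ℝ} (hp : 1 ≤ p) (hpd : p < finrank ℝ E') (μ : Measure E')
    [μ.IsAddHaarMeasure] {f : E' → F} (hf : MemSobolevDomain 1 (ENNReal.ofReal p) Ω μ f) :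
    MemLp f (ENNReal.ofReal (finrank ℝ E' * p / (finrank ℝ E' - p))) (μ.restrict Ω) :=
  sobolev_embedding_domain_holds hΩ hb hp hpd μ hf

end Final

section Corrected

variable {E' : Type*} [NormedAddCommGroup E'] [InnerProductSpace ℝ E'] [MeasurableSpace E']
variable {F : Type*} [NormedAddCommGroup F] [NormedSpace ℝ F]

/-- **Discharge of the corrected named fact `sobolev_embedding_domain'`** (Adams–Fournier,
*Sobolev Spaces*, 2nd ed. (2003), Thm. 4.12, Part I, Case C with `m = 1`; Adams (1975),
Lemma 5.10): the hypotheses `[BorelSpace E']`, `[CompleteSpace F]` are bound inside that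
proposition, so it is proved outright, by `sobolev_embedding_domain_holds`. [cite: AdamsFournier2003, Thm. 4.12 Part I Case C (m = 1)] [cite: Adams1975, Thm. 5.4 Part I Case A (4) and Lemma 5.10] -/
theorem sobolev_embedding_domain'_holds : sobolev_embedding_domain' (E' := E') (F := F) := by
  intro _ _
  exact sobolev_embedding_domain_holds

end Corrected

end Literature.Analysis.FunctionSpaces
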